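import Mathlib
import HarnessLib
import HarnessLib.Audit
import Summits.Langlands.Statement
import Literature.NumberTheory.Automorphic.SerreConjecture
import HarnessLib.Audit.Status.Attr

/-!
Route: PhantomRM

CLOSED (retired) 2026-08-15T13:48:43Z by operator:999:1257524 — reason: not-a-thesis: assembly does not conclude the sub-problem Statement — note: D-0027 §2.1 audit (human 2026-08-15: routes that do not decide the summit are removed): the assembly concludes `PhantomRMSector`, not the sub-problem statement; a NEW conforming route may be opened from the same idea (generated `closes : … → _root_.Langlands`).. The file is kept as the record of this route; refuted decls are indexed as negative knowledge (`ledger negatives`).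

# Route PhantomRM — phantom real multiplication — residually Yoshida weight-2 symplectic ρ over ℚ
are automorphic (KW twice for free, then Thorne × BCGP lifting in weight (2,2))

It suffices to show X = PhantomRMSector, a SECTOR of conjunct (B)
`Summit.Langlands.GaloisToAutomorphic 4` over K = ℚ (the route
contributes to direction Galois → automorphic of GL₄-reciprocity over ℚ; it does not claim the
summit `Langlands`, which quantifies over
all n and all number fields, so the frame statement X → Langlands is NOT asserted — the Assembly
below is the glue cruxes → X).
X (card phantom-real-multiplication, its theorem-candidate, stated on the Galois side because the
tree has no GSp₄ / Siegel / Hida API):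
for every odd prime p, every ι : ℚ̄_p ≃ ℂ and every continuous irreducible ρ : Γ_ℚ → GL₄(ℚ̄_p) which
(i) preserves a symplectic form
with multiplier the p-adic cyclotomic character ε (homological convention ρ ≈ V_p(A)), (ii) is
WEIGHT-2 ORDINARY AND p-DISTINGUISHED at p
(ρ|Γ_ℚ_p conjugate to an upper-triangular shape with diagonal (ε·α, ε·β, β⁻¹, α⁻¹), α, β unramified
characters, ᾱ ≠ β̄), and (iii) is
RESIDUALLY OF YOSHIDA TYPE: ρ̄^ss ≅ σ̄ ⊕ σ̄' (read off the Frobenius characteristic polynomials at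
almost all places through a reduction
map 𝒪_ℚ̄_p → k, k ⊇ 𝔽̄_p algebraically closed) with σ̄, σ̄' : Γ_ℚ → GL₂(k) odd, irreducible, both of
determinant ε̄ and non-isomorphic —
there is an L-algebraic cuspidal automorphic representation π of GL₄(𝔸_ℚ) whose Satake parameters
match ρ at almost all places
(the conclusion shape of `Literature.NumberTheory.Automorphic.FontaineMazurLanglandsGLn`). PHANTOM
RM is the motivating source of such ρ:
an abelian surface A/ℚ with End(A_ℚ̄) = ℤ whose p-torsion is 𝔽_p-irreducible with commutant 𝔽_p² of
Sp₂(p²)-type (Aschbacher C₃,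
degree 2) has ρ̄ ⊗ 𝔽̄_p = σ̄ ⊕ σ̄^(p) of exactly this shape (support item PhantomRMTransport), so by
Khare–Wintenberger applied to σ̄ and
σ̄^(p) it is residually Yoshida-AUTOMORPHIC for free — the class of 3-torsion images that
BoxerCalegariGeePilloni2025 must exclude
(absolutely reducible) is the one where Serre's conjecture for GSp₄(𝔽_p) is already a theorem.
Lean: `∀ (p : ℕ) [Fact p.Prime], p ≠ 2 → ∀ (k : Type) [Field k] [CharP k p] [IsAlgClosed k]
[TopologicalSpace k] [DiscreteTopology k] (red : Valued.integer (PadicAlgCl p) →+* k) (σ σ' :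
Literature.NumberTheory.GaloisRepresentations.FramedGaloisRep ℚ k 2) (hcpt :
Literature.NumberTheory.Automorphic.isCompact_glFiniteIntegralLevel 4 ℚ) (ι : (PadicAlgCl p) ≃+* ℂ)
(ρ : Literature.NumberTheory.GaloisRepresentations.FramedGaloisRep ℚ (PadicAlgCl p) 4), σ.IsOdd →
σ'.IsOdd → σ.toGaloisRep.IsIrreducible → σ'.toGaloisRep.IsIrreducible → (∀ g,
Literature.NumberTheory.GaloisRepresentations.FramedRep.det σ g =
Literature.NumberTheory.GaloisRepresentations.modPCyclotomicCharacter ℚ k p (ZMod.castHom (dvd_refl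
p) k) g ∧ Literature.NumberTheory.GaloisRepresentations.FramedRep.det σ' g =
Literature.NumberTheory.GaloisRepresentations.FramedRep.det σ g) → (∃ v, ∃ P P' : Polynomial k,
σ.IsUnramifiedAt v ∧ σ'.IsUnramifiedAt v ∧ σ.HasFrobCharpolyAt v P ∧ σ'.HasFrobCharpolyAt v P' ∧ P ≠
P') → ρ.toGaloisRep.IsIrreducible → (∃ J : Matrix (Fin 4) (Fin 4) (PadicAlgCl p), J.transpose = -J ∧
J.det ≠ 0 ∧ ∀ g, (ρ g).val.transpose * J * (ρ g).val = (algebraMap ℚ_[p] (PadicAlgCl p)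
(((Literature.NumberTheory.GaloisRepresentations.GaloisRep.cyclotomicCharacter ℚ p g : ℤ_[p]ˣ) :
ℤ_[p]) : ℚ_[p])) • J) → (∀ (v : IsDedekindDomain.HeightOneSpectrum (NumberField.RingOfIntegers ℚ)),
((p : ℕ) : NumberField.RingOfIntegers ℚ) ∈ v.asIdeal → ∃ (g : Matrix.GeneralLinearGroup (Fin 4)
(PadicAlgCl p)) (α β : Field.absoluteGaloisGroup (v.adicCompletion ℚ) →* (PadicAlgCl p)ˣ), (∀ τ ∈
Literature.NumberTheory.GaloisRepresentations.absInertia (v.adicCompletion ℚ), α τ = 1 ∧ β τ = 1) ∧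
(∃ τ, Valued.v ((α τ : PadicAlgCl p) - β τ) = 1) ∧ ∀ τ, (fun (e : PadicAlgCl p) (M : Matrix (Fin 4)
(Fin 4) (PadicAlgCl p)) => (∀ i j : Fin 4, j < i → M i j = 0) ∧ M 0 0 = e * α τ ∧ M 1 1 = e * β τ ∧
M 2 2 = ((β τ)⁻¹ : (PadicAlgCl p)ˣ) ∧ M 3 3 = ((α τ)⁻¹ : (PadicAlgCl p)ˣ)) (algebraMap ℚ_[p]
(PadicAlgCl p) (((Literature.NumberTheory.GaloisRepresentations.GaloisRep.cyclotomicCharacter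
(v.adicCompletion ℚ) p τ : ℤ_[p]ˣ) : ℤ_[p]) : ℚ_[p])) (g⁻¹ * ρ.toLocal v τ * g).val) → (∀ᶠ v in
Filter.cofinite, ρ.IsUnramifiedAt v ∧ σ.IsUnramifiedAt v ∧ σ'.IsUnramifiedAt v ∧ ∃ (P : Polynomial
(Valued.integer (PadicAlgCl p))) (P₁ P₂ : Polynomial k), ρ.HasFrobCharpolyAt v (P.map
(Valued.integer (PadicAlgCl p)).subtype) ∧ σ.HasFrobCharpolyAt v P₁ ∧ σ'.HasFrobCharpolyAt v P₂ ∧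
P.map red = P₁ * P₂) → (∃ π : Literature.NumberTheory.Automorphic.CuspidalAutomorphicRepData 4 ℚ
hcpt, π.1.IsLAlgebraic ∧ ∀ᶠ v in Filter.cofinite, ∃ a : Multiset ℂ, π.1.HasSatakeParamAt v a ∧
ρ.IsUnramifiedAt v ∧ ρ.HasFrobCharpolyAt v
(Literature.NumberTheory.Automorphic.arithFrobPolyOfSatake ι v.residueCard 1 a))`

## Assembly
Pure logic (checked sorry-free as an `example` in the planner's Sketch.lean): fix the data of X;
SerreWeakKW applied to σ̄ and to σ̄'
(odd, irreducible) yields newforms, i.e. the modularity hypotheses of StableYoshidaCongruence; the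
sector's own ρ witnesses its
"∃ ordinary symplectic lift with this residual pair" hypothesis, so it returns an irreducible
automorphic ρ₀ with the same local shape and
residual pair; ResiduallyYoshidaLifting transfers automorphy from ρ₀ to ρ. Every hypothesis is
passed on syntactically (modus ponens);
no cone fact is consumed by the glue. PhantomRMTransport is support: it feeds X's hypotheses from
the phantom-RM residual image and is not
in the implication chain.

Rationale: WHY THIS LINE. Mechanism (card phantom-real-multiplication, graded new-combination): residual
automorphy is FREE on the Aschbacher-C₃ (degree 2,
Sp₂(p²)-type) class — ρ̄ ⊗ 𝔽̄_p = σ̄ ⊕ σ̄^(p) with σ̄ odd irreducible, so KhareWintenberger2009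
(tree: named fact
`Literature.NumberTheory.Automorphic.exists_newform_of_odd_irreducible`, lang.S37) makes ρ̄ the
reduction of the Yoshida/endoscopic
transfer of a pair of weight-2 newforms; modularity of ρ is then a LIFTING problem from a residually
ENDOSCOPIC point to a STABLE one in the
irregular weight (2,2), i.e. the join — never made in print — of Thorne2014 / AllenNewtonThorne2020
(reducibility-ideal patching for
residually multiplicity-free reducible polarized ρ̄, ordinary, regular weight, unitary groups) with
BoxerEtAl2021 / BoxerCalegariGeePilloni2025
(higher Hida theory + Calegari–Geraghty patching of 2-term ordinary complexes on the Siegel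
threefold, classicality in weight 2; they REQUIRE
ρ̄ absolutely irreducible, "vast and tidy"). Imported areas: finite group theory (Aschbacher's
maximal-subgroup classes of GSp₄(𝔽_p) as an
organising principle for residual images), Iwasawa/Hida theory of Yoshida congruences
(BochererDummiganSchulzePillot2012, HsiehPalvannan2025:
the Yoshida locus inside GSp₄ ordinary families and its congruence ideal = Rankin–Selberg p-adic L /
Selmer), level-raising on GSp₄
(Sorensen2006, Sorensen2009 for Saito–Kurokawa packets). The route is typed purely Galois-side in
the summit's own vocabulary
(FramedGaloisRep, CuspidalAutomorphicRepData 4 ℚ, arithFrobPolyOfSatake) — the GSp₄ automorphic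
objects live inside the proofs, and the
GSp₄ → GL₄ transfer (Arthur2013; Gee–Taïbi arXiv:1807.03988) turns a weight-2 Siegel eigenform into
the L-algebraic cuspidal π of X.
No prior route exists on this summit; the negatives index is empty.

RANKED CRUXES. #0 PhantomRMSector (target) — X as in § Thesis: every odd p, every irreducible
symplectic-ε, weight-2 ordinary p-distinguished ρ : Γ_ℚ → GL₄(ℚ̄_p) whose residual
semisimplification is an orthogonal Yoshida pair σ̄ ⊕ σ̄' (both odd, irreducible, det ε̄, σ̄ ≇ σ̄')
is automorphic: an L-algebraic cuspidal π on GL₄(𝔸_ℚ) matches ρ at almost all places. Hypotheses σ̄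
odd / det ε̄ are deliberately redundant (oddness follows from det ε̄, p odd) so that the glue is
syntactic. (why it might fail: it contains the residually-reducible irregular-weight lifting problem
(cruxes 3, 4); a residually Yoshida ρ with an obstructed (full-dimensional) reducible deformation
locus, or p = 3 small-image pathologies of σ̄(Γ_ℚ(ζ₃)), could make the sector statement unreachable
though true.) [BoxerCalegariGeePilloni2025, BoxerEtAl2021, Thorne2014, AllenNewtonThorne2020,
KhareWintenberger2009]
#2 SerreWeakKW (crux) — NAMED-FACT GATE (payload rule: the unproved named fact the mechanism rests
on is the first crux). Serre's conjecture, weak form = Khare–Wintenberger–Kisin: every continuous,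
irreducible, odd ρ̄ : Γ_ℚ → GL₂(k), k algebraically closed of characteristic p, arises from a
newform of some level and weight. This is VERBATIM the tree's named fact
`Literature.NumberTheory.Automorphic.exists_newform_of_odd_irreducible` (lang.S37, cite pending),
universally quantified over p and k; it is a THEOREM in print (KhareWintenberger2009 Thm 1.2 + Kisin
2009 for p = 2) and closes when that fact is discharged or accepted as a hypothesis by the assessor.
It is the free residual input: applied to σ̄ and to σ̄' it makes every ρ of the sector residually
Yoshida-automorphic. [difficulty: XL] (why it might fail: mathematically it cannot (theorem in
print); the risk is the Lean rendering of lang.S37 — the normalisation of `IsGaloisRepOfNewform1Int`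
(arithmetic Frobenius, Hecke polynomial X² − a_q X + ε(q)q^(w−1) over 𝓞_f) or the `CuspForm (Gamma1
N) w` / `IsNewform1` packaging being subtly unsatisfiable.) [KhareWintenberger2009, Serre1987,
Khare2006]
#3 ResiduallyYoshidaLifting (crux) — RELATIVE AUTOMORPHY LIFTING IN THE RESIDUALLY-YOSHIDA,
WEIGHT-(2,2) ORDINARY CASE (card P1+P2 = (★) "R^(ord,(2,2))_ρ̄ = T" + classicality, GL₄-side): p
odd; σ̄, σ̄' : Γ_ℚ → GL₂(k) odd, irreducible, det ε̄, non-isomorphic; ρ₀, ρ : Γ_ℚ → GL₄(ℚ̄_p) both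
irreducible, symplectic with multiplier ε, weight-2 ordinary p-distinguished at p, both with
residual semisimplification σ̄ ⊕ σ̄' (same reduction map); if ρ₀ is automorphic (L-algebraic
cuspidal π₀ on GL₄/ℚ matching a.e.) then so is ρ. Engine: BCGP higher-Hida 2-term complexes and
Calegari–Geraghty patching (ℓ₀ = 1) with Thorne/ANT reducibility-ideal bookkeeping (Taylor–Wiles
primes chosen for the two constituents, 'adequate' replaced by conditions on σ̄, σ̄' restricted to
Γ_ℚ(ζ_p)), rigidified over W(k) (End(ρ̄) = 𝔽_p² in the phantom-RM case), then BCGP2025-style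
classicality of the ordinary weight-2 eigensystem at an endoscopic-congruent maximal ideal, then
GSp₄ → GL₄ transfer. Lean form: `Sh r` is a `let`-abbreviation for the conjunction (symplectic with
multiplier ε) ∧ (weight-2 ordinary p-distinguished at p) ∧ (residual pair (σ̄,σ̄') through red) —
the three clauses written out in full in PhantomRMSector — and `Aut r` abbreviates the automorphy
clause; both zeta-reduce, so the statement is literally the Target with the extra automorphic ρ₀.
[deps: StableYoshidaCongruence] [difficulty: open-problem] (why it might fail: the reducible
(Yoshida) locus of R^ord may be full-dimensional when H¹_ord(ℚ, Hom(σ̄',σ̄)(1)) ≠ 0 (Thorne's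
mechanism then has no grip); Ihara avoidance and BCGP 'tidiness' at p vs a reducible ρ̄;
multiplicity one / classicality at Eisenstein-endoscopic maximal ideals; p = 3 solvable σ̄(Γ_ℚ).)
[Thorne2014, AllenNewtonThorne2020, BoxerEtAl2021, BoxerCalegariGeePilloni2025, SkinnerWiles1999,
HsiehPalvannan2025, CalegariGeraghty2017]
#4 StableYoshidaCongruence (crux) — A STABLE AUTOMORPHIC POINT ON THE ORDINARY DEFORMATION SPACE OF
σ̄ ⊕ σ̄' (Yoshida → stable congruence, auxiliary level allowed; the automorphic input Thorne-type
patching needs): p odd; σ̄, σ̄' : Γ_ℚ → GL₂(k) MODULAR (arise from newforms, as output by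
SerreWeakKW), irreducible, det ε̄, non-isomorphic; if SOME ρ : Γ_ℚ → GL₄(ℚ̄_p) (possibly reducible,
e.g. ρ_f ⊕ ρ_g, or the sector's own ρ) is symplectic-ε, weight-2 ordinary p-distinguished with
residual semisimplification σ̄ ⊕ σ̄', then for every ι there is an IRREDUCIBLE such ρ₀ which is
automorphic (L-algebraic cuspidal π₀ on GL₄/ℚ matching a.e.) — i.e. a stable weight-2 ordinary
Siegel eigenform (of some level) congruent to the Yoshida eigensystem of the pair. Engines:
level-raising at auxiliary primes from the endoscopic packet (Sorensen2006; Sorensen2009 does this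
for Saito–Kurokawa packets) in coherent H⁰/H¹ of the Siegel threefold; or congruence-ideal
divisibility p | L_alg(f ⊗ g) (BochererDummiganSchulzePillot2012, Agarwal–Klosin,
HsiehPalvannan2025); or a Diophantine engine: a BCGP-modular genus-2 Jacobian (big image at 3) with
prescribed mod-p semisimplification (twisted A₂(p); rational for p = 3 via the Burkhardt quartic).
Lean form: `Sh` as in ResiduallyYoshidaLifting (symplectic-ε ∧ ordinary p-distinguished ∧ residual
pair), `Modular s` = the conclusion of `exists_newform_of_odd_irreducible` for s (∃ level, weight,
newform f, ι_f : 𝓞_f → k with `IsGaloisRepOfNewform1Int`). [deps: SerreWeakKW] [difficulty: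
open-problem] (why it might fail: at fixed tame level the Yoshida eigensystem is ISOLATED when the
Rankin–Selberg Selmer group is finite (HsiehPalvannan2025), so auxiliary level is essential;
endoscopic→stable level-raising for Yoshida packets in weight (2,2) is unproved (Saito–Kurokawa
only: Sorensen2009); sign obstructions.) [HsiehPalvannan2025, Sorensen2009, Sorensen2006,
BochererDummiganSchulzePillot2012, BergerKlosin2020, BoxerCalegariGeePilloni2025, arXiv:2607.13100]
#9 PhantomRMTransport (support) — THE TRANSPORT LEMMA (card P3; pure linear algebra + Galois theory,
provable now): p odd, k ⊇ 𝔽̄_p algebraically closed; ρ̄ : Γ_ℚ → GL₄(𝔽_p) continuous,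
𝔽_p-irreducible, preserving an alternating nondegenerate J with multiplier the mod-p cyclotomic
character, whose commutant is EXACTLY 𝔽_p[Φ] ≅ 𝔽_p² (Φ² = aΦ + b, X² − aX − b irreducible) with Φ
J-SELF-ADJOINT (Φᵀ J = J Φ: the Sp₂(p²)-type of Aschbacher class C₃, orthogonal eigenplanes — not
the GU₂(p)-type). Then ρ̄ ⊗ k is conjugate to the block-diagonal σ ⊕ σ^(p) with σ : Γ_ℚ → GL₂(k)
odd, absolutely irreducible, det σ = ε̄, σ ≇ σ^(p) (witnessed by distinct Frobenius characteristic
polynomials at an unramified place). Proof sketch: Φ ⊗ k has eigenvalues λ ≠ λ^p with Γ-stable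
eigenplanes W, F(W) (F = arithmetic Frobenius of k acting on 𝔽_p⁴ ⊗ k); Φ* = Φ forces W ⊥ F(W) ((λ −
λ^p)⟨x,y⟩ = 0), so each eigenplane is J-nondegenerate (orthogonal symplectic planes), det σ =
multiplier = ε̄ and σ is odd as ε̄(c) = −1 for p odd; in the GU₂(p)-type Φ* = Φ^p the planes would
instead be isotropic and σ' ≅ σ^∨ ⊗ ε̄; End = 𝔽_p² gives absolute irreducibility of σ and σ ≇ σ^(p)
(else ρ̄ would be isotypic over 𝔽_p, contradicting 𝔽_p-irreducibility via Brauer(𝔽_p) = 0).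
[difficulty: M] [Aschbacher1984, KhareWintenberger2009, BoxerCalegariGeePilloni2025]

TWO-LAYER PLAN. Foreseen glued splits (filed only after a crux closes or a census asks):
ResiduallyYoshidaLifting ⇐ (L1) ordinary R^ord_Λ = T^ord_Λ over
the two-variable GSp₄ Hida family at the residually-Yoshida maximal ideal in REGULAR weights
(Thorne-style, where Galois representations and
classicality are classical) → (L2) weight-(2,2) specialisation + classicality of the ordinary
eigensystem (BCGP higher Hida theory, multiplicity
one at an endoscopic-congruent ideal) → ResiduallyYoshidaLifting. StableYoshidaCongruence ⇐ (S1)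
level-raising Yoshida → stable at one
auxiliary prime q (GSp₄ Ribet lemma in coherent cohomology) → (S2) ordinarity/p-distinguishedness is
preserved along the congruence →
StableYoshidaCongruence; alternative family (separate route if pursued): the Diophantine engine via
twisted A₂(p) and BCGP-modular Jacobians.
A regular-weight DRESS REHEARSAL (same statement with distinct Hodge–Tate weights, provable today
from AllenNewtonThorne2020 over an
imaginary quadratic field + quadratic descent?) is filed as an informal support item after open.

KILL CRITERIA. (i) A residually-Yoshida, weight-2 ordinary p-distinguished symplectic ρ over ℚ that
is provably NOT automorphic would refute X and (B)
itself — not expected; realistic kills are structural: (ii) a Greenberg–Wiles computation showing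
the reducible locus of the weight-(2,2)
ordinary symplectic deformation ring of σ̄ ⊕ σ̄' is generically of full dimension (Selmer classes in
H¹(ℚ, Hom(σ̄',σ̄)) unobstructed) — then
ResiduallyYoshidaLifting has no mechanism: close `exhausted` with census, or pivot to the p |
L(f⊗g)-divisible sub-sector; (iii) a proof
that endoscopic → stable level-raising is obstructed for Yoshida packets at every auxiliary prime
(sign/epsilon constraints) refutes
StableYoshidaCongruence as stated — pivot to the congruence-ideal sub-sector (p | L_alg(f ⊗ g)) by
`--restate`; (iv) if SerreWeakKW's Lean
rendering is refuted (mis-statement of lang.S37), restate against the corrected named fact — the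
mathematics is a theorem. A BCGP sequel
proving Serre-type residual automorphy for ALL GSp₄(𝔽₃)-images would make the route `superseded`
(known), not wrong.

NOT DECOMPOSED YET. Everything inside the two genuine cruxes: Taylor–Wiles prime existence for the
pair (σ̄, σ̄'), the reducibility ideal and the dimension
bound for the Yoshida locus, Ihara avoidance in irregular weight, the doubling / Cousin = Sen
classicality step, multiplicity one; the
upgrade from almost-everywhere Satake matching to the summit's full `Corresponds 𝓡 ι π ρ`
(local–global compatibility at ramified places and
at p for weight-(2,2) transfers: Mok2014-type results; a separate support item once X moves); the
abelian-surface dictionary (V_p(A) of a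
phantom-RM surface satisfies (i)–(iii): Weil pairing, ordinary reduction, Serre–Tate) — needs
abelian-surface Galois API the tree lacks and is
bookkeeping, not a crux; the general Aschbacher route map (card P6) and the tensor-decomposable
second instance (card P4) — other cards/routes.

CHEAPEST FALSIFIER. (1) Pen-and-paper, one afternoon: the Greenberg–Wiles Euler-characteristic count
for ad ρ̄ = ad σ̄ ⊕ ad σ̄' ⊕ Hom(σ̄,σ̄') ⊕ Hom(σ̄',σ̄) with the
weight-(2,2) ordinary local condition at p — if the expected dimension of the reducible (Yoshida)
locus equals that of the whole ordinary
deformation space for generic pairs, crux 3 is dead on arrival. (2) LMFDB/kit census (card test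
(i)–(ii)): genus-2 curves over ℚ with
End = ℤ, good ordinary at p ∈ {3,5}, mod-p image 𝔽_p-irreducible but absolutely reducible; check the
Sp₂(p²)- vs GU₂(p)-type split and that
σ̄ matches a classical weight-2 newform mod λ with residue field 𝔽_p² (a mismatch refutes
PhantomRMTransport's typing, not KW); then look
for a congruent STABLE paramodular/Siegel eigenform of small level in the LMFDB Siegel data
(evidence for crux 4). (3) Lookup: does
HsiehPalvannan2025 §1 (rigidity of the Yoshida family) already contradict StableYoshidaCongruence at
AUXILIARY level? (read pp. 3–4: no —
their uniqueness is at fixed tame level N_F·N_G under Bloch–Kato finiteness, which is exactly why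
crux 4 allows auxiliary level).

NUMBERS. Items at open: 6 (1 target, 3 cruxes of which 1 is a named-fact gate, 1 support, 1
assembly). Signature lengths 176–3389 chars (one-line
Props, `let`-abbreviations Sh/Aut/Modular inside; definition requests below would shrink them). BCGP
2025: modularity of A/ℚ needs good ordinary reduction at 3 and ρ̄_{A,3} surjective
or in an explicit list of absolutely irreducible subgroups of GSp₄(𝔽₃) (arXiv:2502.20645 Thm 1.1) —
every absolutely reducible image, in
particular every phantom-RM surface at 3, is outside. |GSp₄(𝔽₃)| = 103680; the C₃ subgroup (GL₂(𝔽₉)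
with 𝔽₃-rational determinant).2 has
order 2·|SL₂(𝔽₉)|·|𝔽₃ˣ|… (to be tabulated by the census). Thorne2014: residually ρ̄ = ρ̄₁ ⊕ ρ̄₂
multiplicity-free, ordinary, regular weight,
CM field, unitary group; ANT2020: characters. Sorensen2009: level-raising for Saito–Kurokawa (CAP)
packets at primes q with a Frobenius
condition; nothing in print for Yoshida packets (searched).

DEFINITION REQUESTS. To be filed after open (`ledger workitem add --kind definition`), all in
Literature/NumberTheory/GaloisRepresentations, each replacing a
verbatim sub-formula of the signatures: (D1) `FramedGaloisRep.IsSymplecticWithMultiplier ρ χ` (∃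
alternating nondegenerate J, ρᵀJρ = χ J);
(D2) `FramedGaloisRep.IsWeightTwoOrdinaryDistinguishedAt ρ v` (the upper-triangular (εα, εβ, β⁻¹,
α⁻¹) shape, α,β unramified, ᾱ ≠ β̄);
(D3) `FramedGaloisRep.HasResidualPair ρ red σ σ'` (a.e. Frobenius characteristic polynomial of ρ is
integral and reduces to charpoly σ ·
charpoly σ'); (D4) `FramedGaloisRep.IsAutomorphicAE ι ρ hcpt` (∃ L-algebraic cuspidal π on GL_n with
a.e. Satake matching — the conclusion
of FontaineMazurLanglandsGLn as a predicate). Cite facts wanted as hypotheses later (not now): GSp₄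
→ GL₄ transfer (Arthur2013 / Gee–Taïbi
arXiv:1807.03988), Galois representations for weight-(2,2) Siegel eigenforms (Taylor 1991,
Weissauer, Mok2014-type local–global
compatibility), BoxerEtAl2021 Thm 1.1 as a named fact.

Novelty: Searches (2026-08-15; local searchd DOWN, OpenAlex/arXiv/S2 rate-limited, zbMATH answering): `lit
search --source zbmath "Yoshida lift
congruence"` (4: BochererDummiganSchulzePillot2012 = arXiv:1012.5817; HsiehPalvannan2025 =
arXiv:2505.09975 — NEW FIND, read pp. 1–4:
rigidity of the Yoshida family at fixed tame level + congruence ideal | char. ideal of the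
Rankin–Selberg Selmer group; Böcherer–Schulze-Pillot
1990; Okazaki 2007), `lit search --source zbmath "level-raising GSp(4)"` (7: Sorensen2006
doi:10.5802/aif.2226, Sorensen2009
doi:10.1112/s0010437x09004084, Astérisque 2025 doi:10.24033/ast.1241, …), `lit search --source
zbmath "residually reducible Galois
representations symplectic automorphy lifting"` (0), `"abelian surfaces modularity residually
reducible"` (0), `lit galaxy search "Yoshida
lift" --star all` (13 rows, none on lifting), `ledger negatives --problem Langlands` (0); plus the
card's five zbMATH queries and reads
(BoxerCalegariGeePilloni2025 pp. 1–6, arXiv:2607.13100 pp. 1–4) and its novelty audit (refuter,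
new-combination).
Nearest prior art found: Thorne2014 (doi:10.1090/s0894-0347-2014-00812-2) + AllenNewtonThorne2020
(arXiv:1912.11269): residually reducible
multiplicity-free polarized lifting, ordinary, REGULAR weight, unitary groups — one half;
BoxerEtAl2021 (arXiv:1812.09269) +
BoxerCalegariGeePilloni2025 (arXiv:2502.20645): weight-(2,2) higher-Hida patching + classicality for
GSp₄, ρ̄ ABSOLUTELY IRREDUCIBLE required
— the other half; BergerKlosin2020 (  [refs: 10.5802/aif.2226, 10.1112/s0010437x09004084, 10.24033/ast.1241, 10.1090/s0894-0347-2014-00812-2, 1012.5817, 2505.09975, 2607.13100, 1912.11269, 1812.09269, 2502.20645, doi:10.5802/aif.2226, doi:10.1112/s0010437x09004084, doi:10.24033/ast.1241, doi:10.1090/s0894-0347-2014-00812-2, BochererDummiganSchulzePillot2012, HsiehPalvannan2025, Sorensen2006, Sorensen2009, BoxerCalegariGeePilloni2025, Thorne2]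

Barriers (technique_class: taylor-wiles patching automorphy-lifting): - technique_class: taylor-wiles patching automorphy-lifting
- Literature.Barriers.Langlands.ResiduallyReducibleBarrier: ENGAGED HEAD-ON and evaded by the
barrier's own printed evasion — ρ̄ ⊗ 𝔽̄_p is reducible but MULTIPLICITY-FREE with both constituents
odd and modular, the Skinner–Wiles / Thorne2014 / AllenNewtonThorne2020 reducibility-ideal regime,
transplanted from regular weight on unitary groups to weight (2,2) on GSp₄; crux 3's why-might-fail
(full-dimensional reducible locus) is exactly the barrier's failure mode and the route's cheapest
falsifier (1) tests it first.
- Literature.Barriers.Langlands.NonRegularWeightBarrier: engaged (Hodge–Tate weights 0,0,1,1; limit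
of discrete series at ∞) and evaded by the COHERENT route the barrier itself lists under
evasions_known — higher Hida theory / higher coherent cohomology of the Siegel threefold and
Calegari–Geraghty patching of 2-term complexes (BoxerEtAl2021, BoxerCalegariGeePilloni2025),
imported wholesale; nothing new is claimed about the weight, and the Galois side needs no
Hodge–Tate-regular input because weight-2 ordinarity is imposed as an explicit triangular shape at
p.
- Literature.Barriers.Langlands.TaylorWilesNumericalCoincidence: the numerical coincidence fails by
exactly ℓ₀ = 1 for GSp₄/ℚ in weight (2,2); evaded as in Calegari–Geraghty / BCGP by patching
complexes in two degrees (coherent H⁰ and H¹) rather than a single degree; the reducible residual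
image only changes the Taylor–Wiles-prime bookkeeping (primes

History (route lifecycle, newest last):
- 2026-08-15T13:48:44Z · CLOSED retired — not-a-thesis: assembly does not conclude the sub-problem Statement (operator:999:1257524)

sub-problem: Langlands · status: closed(retired) · opened planner-plancard-Langlands-Langlands-phantom--6516ef8a-0 2026-08-15T11:21:36Z · rev 1 · ledger route-Langlands-PhantomRM
GENERATED by the gate from the ledger (D-0016/17). Provers cite these decls: `theorem foo : Summit.Langlands.Langlands.Theses.PhantomRM.<Decl> := …` in Summits/Langlands/Langlands/Theorems/<Name>.lean.
-/

namespace Summit.Langlands.Langlands.Theses.PhantomRM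

open scoped BigOperators Topology Manifold Classical MeasureTheory ProbabilityTheory Matrix InnerProductSpace ComplexConjugate ContinuousMap
open Filter Set Function TopologicalSpace MeasureTheory

attribute [summit_statement] _root_.Langlands

/-- item stmt-Langlands-3647 · target · rank 0 · closed · moot by None · by planner
why it might fail: As typed, (ii) is Borel-ordinary: entries (0,1),(2,3) are free, unlike BoxerEtAl2021 Def 7.3.1 (zeros ⇒ semistable); a class in H¹(ℚ_p,αβ⁻¹) (h¹=1, h¹_g=0) gives non-de-Rham ρ satisfying (i)–(iii), expected non-automorphic (Fontaine–Mazur) yet irrefutable today. Repaired X still contains cruxes 3–4.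
sources: BoxerEtAl2021, BoxerCalegariGeePilloni2025, Thorne2014, AllenNewtonThorne2020, KhareWintenberger2009, FontaineMazurGeometric1995
[target] X as in § Thesis: every odd p, every irreducible symplectic-ε, weight-2 ordinary
p-distinguished ρ : Γ_ℚ → GL₄(ℚ̄_p) whose residual semisimplification is an orthogonal Yoshida pair
σ̄ ⊕ σ̄' (both odd, irreducible, det ε̄, σ̄ ≇ σ̄') is automorphic: an L-algebraic cuspidal π on
GL₄(𝔸_ℚ) matches ρ at almost all places. Hypotheses σ̄ odd / det ε̄ are deliberately redundant
(oddness follows from det ε̄, p odd) so that the glue is syntactic. -/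
@[route_item "route-Langlands-PhantomRM"]
def PhantomRMSector : Prop :=
  ∀ (p : ℕ) [Fact p.Prime], p ≠ 2 → ∀ (k : Type) [Field k] [CharP k p] [IsAlgClosed k] [TopologicalSpace k] [DiscreteTopology k] (red : Valued.integer (PadicAlgCl p) →+* k) (σ σ' : Literature.NumberTheory.GaloisRepresentations.FramedGaloisRep ℚ k 2) (hcpt : Literature.NumberTheory.Automorphic.isCompact_glFiniteIntegralLevel 4 ℚ) (ι : (PadicAlgCl p) ≃+* ℂ) (ρ : Literature.NumberTheory.GaloisRepresentations.FramedGaloisRep ℚ (PadicAlgCl p) 4), σ.IsOdd → σ'.IsOdd → σ.toGaloisRep.IsIrreducible → σ'.toGaloisRep.IsIrreducible → (∀ g, Literature.NumberTheory.GaloisRepresentations.FramedRep.det σ g = Literature.NumberTheory.GaloisRepresentations.modPCyclotomicCharacter ℚ k p (ZMod.castHom (dvd_refl p) k) g ∧ Literature.NumberTheory.GaloisRepresentations.FramedRep.det σ' g = Literature.NumberTheory.GaloisRepresentations.FramedRep.det σ g) → (∃ v, ∃ P P' : Polynomial k, σ.IsUnramifiedAt v ∧ σ'.IsUnramifiedAt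 v ∧ σ.HasFrobCharpolyAt v P ∧ σ'.HasFrobCharpolyAt v P' ∧ P ≠ P') → ρ.toGaloisRep.IsIrreducible → (∃ J : Matrix (Fin 4) (Fin 4) (PadicAlgCl p), J.transpose = -J ∧ J.det ≠ 0 ∧ ∀ g, (ρ g).val.transpose * J * (ρ g).val = (algebraMap ℚ_[p] (PadicAlgCl p) (((Literature.NumberTheory.GaloisRepresentations.GaloisRep.cyclotomicCharacter ℚ p g : ℤ_[p]ˣ) : ℤ_[p]) : ℚ_[p])) • J) → (∀ (v : IsDedekindDomain.HeightOneSpectrum (NumberField.RingOfIntegers ℚ)), ((p : ℕ) : NumberField.RingOfIntegers ℚ) ∈ v.asIdeal → ∃ (g : Matrix.GeneralLinearGroup (Fin 4) (PadicAlgCl p)) (α β : Field.absoluteGaloisGroup (v.adicCompletion ℚ) →* (PadicAlgCl p)ˣ), (∀ τ ∈ Literature.NumberTheory.GaloisRepresentations.absInertia (v.adicCompletion ℚ), α τ = 1 ∧ β τ = 1) ∧ (∃ τ, Valued.v ((α τ : PadicAlgCl p) - β τ) = 1) ∧ ∀ τ, (fun (e : PadicAlgCl p) (M : Matrix (Fin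 4) (Fin 4) (PadicAlgCl p)) => (∀ i j : Fin 4, j < i → M i j = 0) ∧ M 0 0 = e * α τ ∧ M 1 1 = e * β τ ∧ M 2 2 = ((β τ)⁻¹ : (PadicAlgCl p)ˣ) ∧ M 3 3 = ((α τ)⁻¹ : (PadicAlgCl p)ˣ)) (algebraMap ℚ_[p] (PadicAlgCl p) (((Literature.NumberTheory.GaloisRepresentations.GaloisRep.cyclotomicCharacter (v.adicCompletion ℚ) p τ : ℤ_[p]ˣ) : ℤ_[p]) : ℚ_[p])) (g⁻¹ * ρ.toLocal v τ * g).val) → (∀ᶠ v in Filter.cofinite, ρ.IsUnramifiedAt v ∧ σ.IsUnramifiedAt v ∧ σ'.IsUnramifiedAt v ∧ ∃ (P : Polynomial (Valued.integer (PadicAlgCl p))) (P₁ P₂ : Polynomial k), ρ.HasFrobCharpolyAt v (P.map (Valued.integer (PadicAlgCl p)).subtype) ∧ σ.HasFrobCharpolyAt v P₁ ∧ σ'.HasFrobCharpolyAt v P₂ ∧ P.map red = P₁ * P₂) → (∃ π : Literature.NumberTheory.Automorphic.CuspidalAutomorphicRepData 4 ℚ hcpt, π.1.IsLAlgebraic ∧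 ∀ᶠ v in Filter.cofinite, ∃ a : Multiset ℂ, π.1.HasSatakeParamAt v a ∧ ρ.IsUnramifiedAt v ∧ ρ.HasFrobCharpolyAt v (Literature.NumberTheory.Automorphic.arithFrobPolyOfSatake ι v.residueCard 1 a))

/-- item stmt-Langlands-3649 · crux · rank 3 · closed · moot by None · by planner
why it might fail: As typed Sh is Borel-ordinary (BoxerEtAl2021 Def 7.3.1 has zeros at (0,1),(2,3) ⇒ semistable): a class in H¹(ℚ_p,αβ⁻¹) (h¹=1, h¹_g=0) gives non-de-Rham ρ with Sh ρ, expected non-automorphic. Repaired: Yoshida locus of R^ord may be full-dimensional (Thorne2014); wt-(2,2) classicality at endoscopic 𝔪.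
sources: BoxerEtAl2021, Thorne2014, AllenNewtonThorne2020, BoxerCalegariGeePilloni2025, SkinnerWiles1999, CalegariGeraghty2017
[crux] RELATIVE AUTOMORPHY LIFTING IN THE RESIDUALLY-YOSHIDA, WEIGHT-(2,2) ORDINARY CASE (card P1+P2
= (★) "R^(ord,(2,2))_ρ̄ = T" + classicality, GL₄-side): p odd; σ̄, σ̄' : Γ_ℚ → GL₂(k) odd,
irreducible, det ε̄, non-isomorphic; ρ₀, ρ : Γ_ℚ → GL₄(ℚ̄_p) both irreducible, symplectic with
multiplier ε, weight-2 ordinary p-distinguished at p, both with residual semisimplification σ̄ ⊕ σ̄'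
(same reduction map); if ρ₀ is automorphic (L-algebraic cuspidal π₀ on GL₄/ℚ matching a.e.) then so
is ρ. Engine: BCGP higher-Hida 2-term complexes and Calegari–Geraghty patching (ℓ₀ = 1) with
Thorne/ANT reducibility-ideal bookkeeping (Taylor–Wiles primes chosen for the two constituents,
'adequate' replaced by conditions on σ̄, σ̄' restricted to Γ_ℚ(ζ_p)), rigidified over W(k) (End(ρ̄)
= 𝔽_p² in the phantom-RM case), then BCGP2025-style classicality of the ordinary weight-2
eigensystem at an endoscopic-congruent maximal ideal, then GSp₄ → GL₄ transfer. Lean form: `Sh r` is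
a `let`-abbreviation for the conjunction (symplectic with multiplier ε) ∧ (weight-2 ordinary
p-distinguished at p) ∧ (residual pair (σ̄,σ̄') through red) — the three clauses written out in full
in PhantomRMSector — and `Aut r` abbre -/
@[route_item "route-Langlands-PhantomRM", crux]
def ResiduallyYoshidaLifting : Prop :=
  ∀ (p : ℕ) [Fact p.Prime], p ≠ 2 → ∀ (k : Type) [Field k] [CharP k p] [IsAlgClosed k] [TopologicalSpace k] [DiscreteTopology k] (red : Valued.integer (PadicAlgCl p) →+* k) (σ σ' : Literature.NumberTheory.GaloisRepresentations.FramedGaloisRep ℚ k 2) (hcpt : Literature.NumberTheory.Automorphic.isCompact_glFiniteIntegralLevel 4 ℚ) (ι : (PadicAlgCl p) ≃+* ℂ) (ρ₀ ρ : Literature.NumberTheory.GaloisRepresentations.FramedGaloisRep ℚ (PadicAlgCl p) 4), let Sh := fun r : Literature.NumberTheory.GaloisRepresentations.FramedGaloisRep ℚ (PadicAlgCl p) 4 => ((∃ J : Matrix (Fin 4) (Fin 4) (PadicAlgCl p), J.transpose = -J ∧ J.det ≠ 0 ∧ ∀ g, (r g).val.transpose * J * (r g).val = (algebraMap ℚ_[p]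 (PadicAlgCl p) (((Literature.NumberTheory.GaloisRepresentations.GaloisRep.cyclotomicCharacter ℚ p g : ℤ_[p]ˣ) : ℤ_[p]) : ℚ_[p])) • J) ∧ (∀ (v : IsDedekindDomain.HeightOneSpectrum (NumberField.RingOfIntegers ℚ)), ((p : ℕ) : NumberField.RingOfIntegers ℚ) ∈ v.asIdeal → ∃ (g : Matrix.GeneralLinearGroup (Fin 4) (PadicAlgCl p)) (α β : Field.absoluteGaloisGroup (v.adicCompletion ℚ) →* (PadicAlgCl p)ˣ), (∀ τ ∈ Literature.NumberTheory.GaloisRepresentations.absInertia (v.adicCompletion ℚ), α τ = 1 ∧ β τ = 1) ∧ (∃ τ, Valued.v ((α τ : PadicAlgCl p) - β τ) = 1) ∧ ∀ τ, (fun (e : PadicAlgCl p) (M : Matrix (Fin 4) (Fin 4) (PadicAlgCl p)) => (∀ i j : Fin 4, j < i → M i j = 0) ∧ M 0 0 = e * α τ ∧ M 1 1 = e * β τ ∧ M 2 2 = ((β τ)⁻¹ : (PadicAlgCl p)ˣ) ∧ M 3 3 = ((α τ)⁻¹ : (PadicAlgCl p)ˣ)) (algebraMap ℚ_[p] (PadicAlgCl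 p) (((Literature.NumberTheory.GaloisRepresentations.GaloisRep.cyclotomicCharacter (v.adicCompletion ℚ) p τ : ℤ_[p]ˣ) : ℤ_[p]) : ℚ_[p])) (g⁻¹ * r.toLocal v τ * g).val) ∧ (∀ᶠ v in Filter.cofinite, r.IsUnramifiedAt v ∧ σ.IsUnramifiedAt v ∧ σ'.IsUnramifiedAt v ∧ ∃ (P : Polynomial (Valued.integer (PadicAlgCl p))) (P₁ P₂ : Polynomial k), r.HasFrobCharpolyAt v (P.map (Valued.integer (PadicAlgCl p)).subtype) ∧ σ.HasFrobCharpolyAt v P₁ ∧ σ'.HasFrobCharpolyAt v P₂ ∧ P.map red = P₁ * P₂)); let Aut := fun r : Literature.NumberTheory.GaloisRepresentations.FramedGaloisRep ℚ (PadicAlgCl p) 4 => (∃ π : Literature.NumberTheory.Automorphic.CuspidalAutomorphicRepData 4 ℚ hcpt, π.1.IsLAlgebraic ∧ ∀ᶠ v in Filter.cofinite, ∃ a : Multiset ℂ, π.1.HasSatakeParamAt v a ∧ r.IsUnramifiedAt v ∧ r.HasFrobCharpolyAt v (Literature.NumberTheory.Automorphic.arithFrobPolyOfSatake ι v.residueCard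 1 a)); σ.IsOdd → σ'.IsOdd → σ.toGaloisRep.IsIrreducible → σ'.toGaloisRep.IsIrreducible → (∀ g, Literature.NumberTheory.GaloisRepresentations.FramedRep.det σ g = Literature.NumberTheory.GaloisRepresentations.modPCyclotomicCharacter ℚ k p (ZMod.castHom (dvd_refl p) k) g ∧ Literature.NumberTheory.GaloisRepresentations.FramedRep.det σ' g = Literature.NumberTheory.GaloisRepresentations.FramedRep.det σ g) → (∃ v, ∃ P P' : Polynomial k, σ.IsUnramifiedAt v ∧ σ'.IsUnramifiedAt v ∧ σ.HasFrobCharpolyAt v P ∧ σ'.HasFrobCharpolyAt v P' ∧ P ≠ P') → ρ₀.toGaloisRep.IsIrreducible → Sh ρ₀ → Aut ρ₀ → ρ.toGaloisRep.IsIrreducible → Sh ρ → Aut ρ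

/-- item stmt-Langlands-3650 · crux · rank 4 · closed · moot by None · by planner
why it might fail: Needs a STABLE wt-2 ordinary Siegel eigenform congruent (aux. level allowed) to the Yoshida eigensystem of (f,g): endoscopic→stable level-raising for Yoshida packets unproved (Sorensen2009: Saito–Kurokawa only); at fixed tame level the Yoshida family is rigid if Sel(f⊗g) finite (HsiehPalvannan2025).
sources: HsiehPalvannan2025, Sorensen2009, Sorensen2006, BochererDummiganSchulzePillot2012, BergerKlosin2020, BoxerCalegariGeePilloni2025
[crux] A STABLE AUTOMORPHIC POINT ON THE ORDINARY DEFORMATION SPACE OF σ̄ ⊕ σ̄' (Yoshida → stable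
congruence, auxiliary level allowed; the automorphic input Thorne-type patching needs): p odd; σ̄,
σ̄' : Γ_ℚ → GL₂(k) MODULAR (arise from newforms, as output by SerreWeakKW), irreducible, det ε̄,
non-isomorphic; if SOME ρ : Γ_ℚ → GL₄(ℚ̄_p) (possibly reducible, e.g. ρ_f ⊕ ρ_g, or the sector's own
ρ) is symplectic-ε, weight-2 ordinary p-distinguished with residual semisimplification σ̄ ⊕ σ̄',
then for every ι there is an IRREDUCIBLE such ρ₀ which is automorphic (L-algebraic cuspidal π₀ on
GL₄/ℚ matching a.e.) — i.e. a stable weight-2 ordinary Siegel eigenform (of some level) congruent to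
the Yoshida eigensystem of the pair. Engines: level-raising at auxiliary primes from the endoscopic
packet (Sorensen2006; Sorensen2009 does this for Saito–Kurokawa packets) in coherent H⁰/H¹ of the
Siegel threefold; or congruence-ideal divisibility p | L_alg(f ⊗ g)
(BochererDummiganSchulzePillot2012, Agarwal–Klosin, HsiehPalvannan2025); or a Diophantine engine: a
BCGP-modular genus-2 Jacobian (big image at 3) with prescribed mod-p semisimplification (twisted
A₂(p); rational for p = 3 via the Burkhardt qu -/
@[route_item "route-Langlands-PhantomRM", crux]
def StableYoshidaCongruence : Prop :=
  ∀ (p : ℕ) [Fact p.Prime], p ≠ 2 → ∀ (k : Type) [Field k] [CharP k p] [IsAlgClosed k] [TopologicalSpace k] [DiscreteTopology k] (red : Valued.integer (PadicAlgCl p) →+* k) (σ σ' : Literature.NumberTheory.GaloisRepresentations.FramedGaloisRep ℚ k 2), let Sh := fun r : Literature.NumberTheory.GaloisRepresentations.FramedGaloisRep ℚ (PadicAlgCl p) 4 => ((∃ J : Matrix (Fin 4) (Fin 4) (PadicAlgCl p), J.transpose = -J ∧ J.det ≠ 0 ∧ ∀ g, (r g).val.transpose * J * (r g).val = (algebraMap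 ℚ_[p] (PadicAlgCl p) (((Literature.NumberTheory.GaloisRepresentations.GaloisRep.cyclotomicCharacter ℚ p g : ℤ_[p]ˣ) : ℤ_[p]) : ℚ_[p])) • J) ∧ (∀ (v : IsDedekindDomain.HeightOneSpectrum (NumberField.RingOfIntegers ℚ)), ((p : ℕ) : NumberField.RingOfIntegers ℚ) ∈ v.asIdeal → ∃ (g : Matrix.GeneralLinearGroup (Fin 4) (PadicAlgCl p)) (α β : Field.absoluteGaloisGroup (v.adicCompletion ℚ) →* (PadicAlgCl p)ˣ), (∀ τ ∈ Literature.NumberTheory.GaloisRepresentations.absInertia (v.adicCompletion ℚ), α τ = 1 ∧ β τ = 1) ∧ (∃ τ, Valued.v ((α τ : PadicAlgCl p) - β τ) = 1) ∧ ∀ τ, (fun (e : PadicAlgCl p) (M : Matrix (Fin 4) (Fin 4) (PadicAlgCl p)) => (∀ i j : Fin 4, j < i → M i j = 0) ∧ M 0 0 = e * α τ ∧ M 1 1 = e * β τ ∧ M 2 2 = ((β τ)⁻¹ : (PadicAlgCl p)ˣ) ∧ M 3 3 = ((α τ)⁻¹ : (PadicAlgCl p)ˣ)) (algebraMap ℚ_[p]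 (PadicAlgCl p) (((Literature.NumberTheory.GaloisRepresentations.GaloisRep.cyclotomicCharacter (v.adicCompletion ℚ) p τ : ℤ_[p]ˣ) : ℤ_[p]) : ℚ_[p])) (g⁻¹ * r.toLocal v τ * g).val) ∧ (∀ᶠ v in Filter.cofinite, r.IsUnramifiedAt v ∧ σ.IsUnramifiedAt v ∧ σ'.IsUnramifiedAt v ∧ ∃ (P : Polynomial (Valued.integer (PadicAlgCl p))) (P₁ P₂ : Polynomial k), r.HasFrobCharpolyAt v (P.map (Valued.integer (PadicAlgCl p)).subtype) ∧ σ.HasFrobCharpolyAt v P₁ ∧ σ'.HasFrobCharpolyAt v P₂ ∧ P.map red = P₁ * P₂)); let Modular := fun s : Literature.NumberTheory.GaloisRepresentations.FramedGaloisRep ℚ k 2 => (∃ (N : ℕ) (_ : NeZero N) (w : ℕ) (f : CuspForm (CongruenceSubgroup.Gamma1 N) (w : ℤ)) (ιf : Literature.NumberTheory.EllipticCurves.ModularForms.coeffCharIntegers f →+* k), Literature.NumberTheory.EllipticCurves.ModularForms.IsNewform1 f ∧ Literature.NumberTheory.EllipticCurves.ModularForms.IsGaloisRepOfNewform1Int f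 ιf {q | q ∣ N * p} s); Modular σ → Modular σ' → σ.toGaloisRep.IsIrreducible → σ'.toGaloisRep.IsIrreducible → (∀ g, Literature.NumberTheory.GaloisRepresentations.FramedRep.det σ g = Literature.NumberTheory.GaloisRepresentations.modPCyclotomicCharacter ℚ k p (ZMod.castHom (dvd_refl p) k) g ∧ Literature.NumberTheory.GaloisRepresentations.FramedRep.det σ' g = Literature.NumberTheory.GaloisRepresentations.FramedRep.det σ g) → (∃ v, ∃ P P' : Polynomial k, σ.IsUnramifiedAt v ∧ σ'.IsUnramifiedAt v ∧ σ.HasFrobCharpolyAt v P ∧ σ'.HasFrobCharpolyAt v P' ∧ P ≠ P') → (∃ ρ : Literature.NumberTheory.GaloisRepresentations.FramedGaloisRep ℚ (PadicAlgCl p) 4, Sh ρ) → ∀ (hcpt : Literature.NumberTheory.Automorphic.isCompact_glFiniteIntegralLevel 4 ℚ) (ι : (PadicAlgCl p) ≃+* ℂ), ∃ ρ₀ : Literature.NumberTheory.GaloisRepresentations.FramedGaloisRep ℚ (PadicAlgCl p) 4, ρ₀.toGaloisRep.IsIrreducible ∧ Sh ρ₀ ∧ (∃ π : Literature.NumberTheory.Automorphic.CuspidalAutomorphicRepData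 4 ℚ hcpt, π.1.IsLAlgebraic ∧ ∀ᶠ v in Filter.cofinite, ∃ a : Multiset ℂ, π.1.HasSatakeParamAt v a ∧ ρ₀.IsUnramifiedAt v ∧ ρ₀.HasFrobCharpolyAt v (Literature.NumberTheory.Automorphic.arithFrobPolyOfSatake ι v.residueCard 1 a))

/-- item stmt-Langlands-3648 · support · rank 2 · closed · moot by None · by planner
why it might fail: mathematically it cannot (theorem in print); the risk is the Lean rendering of lang.S37 — the normalisation of `IsGaloisRepOfNewform1Int` (arithmetic Frobenius, Hecke polynomial X² − a_q X + ε(q)q^(w−1) over 𝓞_f) or the `CuspForm (Gamma1 N) w` / `IsNewform1` packaging being subtly unsatisfiable.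
sources: KhareWintenberger2009, Kisin2009, Khare2006, Serre1987, doi:10.1007/s00222-009-0205-7, doi:10.1007/s00222-009-0206-6
[crux] NAMED-FACT GATE (payload rule: the unproved named fact the mechanism rests on is the first
crux). Serre's conjecture, weak form = Khare–Wintenberger–Kisin: every continuous, irreducible, odd
ρ̄ : Γ_ℚ → GL₂(k), k algebraically closed of characteristic p, arises from a newform of some level
and weight. This is VERBATIM the tree's named fact
`Literature.NumberTheory.Automorphic.exists_newform_of_odd_irreducible` (lang.S37, cite pending),
universally quantified over p and k; it is a THEOREM in print (KhareWintenberger2009 Thm 1.2 + Kisin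
2009 for p = 2) and closes when that fact is discharged or accepted as a hypothesis by the assessor.
It is the free residual input: applied to σ̄ and to σ̄' it makes every ρ of the sector residually
Yoshida-automorphic. [difficulty: XL] -/
@[route_item "route-Langlands-PhantomRM"]
def SerreWeakKW : Prop :=
  ∀ (p : ℕ) [Fact p.Prime] (k : Type) [Field k] [TopologicalSpace k] [DiscreteTopology k], Literature.NumberTheory.Automorphic.exists_newform_of_odd_irreducible (p := p) (k := k)

/-- item stmt-Langlands-2607 · support · rank 9 · open · by planner
[support] needs-fact ×4 (route-repair 2026-08-15, cone guardrail): the Borel–Jacquet §4.3–4.6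
dictionary for GL_n over every number field K, bundling at the GL_n automorphy datum the four cone
facts route CMFern genuinely rests on —
`Literature.NumberTheory.Automorphic.automorphicForms_isStableSubmodule` (BJ 4.3: the space of
automorphic forms is a (𝔤,K_∞)×G(𝔸_f)-module; needed to build a CuspidalAutomorphicRepData from a
classical eigenform, i.e. by every direction-(B) construction such as ClassicalityOfLimits, rank 4)
and, for every automorphic measure μ,
`Literature.NumberTheory.Automorphic.AutomorphicRepsGL.exists_isAssociatedL2`,
`Literature.NumberTheory.Automorphic.AutomorphicRepsGL.exists_cuspidalRepData_of_L2`,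
`Literature.NumberTheory.Automorphic.hasSatakeParamAt_iff_L2` (BJ 4.4–4.6: (𝔤,K)-module ↔ L²_cusp
bridges and agreement of Satake parameters — exactly the hypotheses hA/hAss/hL2 of the RepData
base-change and cyclic-descent theorems ArthurClozelFibresRepData / CuspidalDescentCyclicRepData on
which AscentConjugationSolvable (rank 5) and ReciprocityCMtoTR run). Source: BorelJacquet1979
§4.3–4.6 (Harish-Chandra, Gelfand–Piatetski-Shapiro). Tier-0 cone debt: closes by th -/
@[route_item "route-Langlands-PhantomRM"]
def BorelJacquetDictionary : Prop :=
  ∀ (n : ℕ) (K : Type) [Field K] [NumberField K] (hcpt : Literature.NumberTheory.Automorphic.isCompact_glFiniteIntegralLevel n K), Literature.NumberTheory.Automorphic.automorphicForms_isStableSubmodule (Literature.NumberTheory.Automorphic.AutomorphyDatum.gl n K hcpt) ∧ ∀ (μ : MeasureTheory.Measure (Literature.NumberTheory.Automorphic.AdelicGroupData.gl n K).automorphicQuotient) [(Literature.NumberTheory.Automorphic.AdelicGroupData.gl n K).IsAutomorphicMeasure μ], Literature.NumberTheory.Automorphic.AutomorphicRepsGL.exists_isAssociatedL2 hcpt μ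 ∧ Literature.NumberTheory.Automorphic.AutomorphicRepsGL.exists_cuspidalRepData_of_L2 hcpt μ ∧ Literature.NumberTheory.Automorphic.hasSatakeParamAt_iff_L2 hcpt μ

/-- item stmt-Langlands-3651 · support · rank 9 · closed · moot by None · by planner
sources: Aschbacher1984, KhareWintenberger2009, BoxerCalegariGeePilloni2025
[support] THE TRANSPORT LEMMA (card P3; pure linear algebra + Galois theory, provable now): p odd, k
⊇ 𝔽̄_p algebraically closed; ρ̄ : Γ_ℚ → GL₄(𝔽_p) continuous, 𝔽_p-irreducible, preserving an
alternating nondegenerate J with multiplier the mod-p cyclotomic character, whose commutant is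
EXACTLY 𝔽_p[Φ] ≅ 𝔽_p² (Φ² = aΦ + b, X² − aX − b irreducible) with Φ J-SELF-ADJOINT (Φᵀ J = J Φ: the
Sp₂(p²)-type of Aschbacher class C₃, orthogonal eigenplanes — not the GU₂(p)-type). Then ρ̄ ⊗ k is
conjugate to the block-diagonal σ ⊕ σ^(p) with σ : Γ_ℚ → GL₂(k) odd, absolutely irreducible, det σ =
ε̄, σ ≇ σ^(p) (witnessed by distinct Frobenius characteristic polynomials at an unramified place).
Proof sketch: Φ ⊗ k has eigenvalues λ ≠ λ^p with Γ-stable eigenplanes W, F(W) (F = arithmetic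
Frobenius of k acting on 𝔽_p⁴ ⊗ k); Φ* = Φ forces W ⊥ F(W) ((λ − λ^p)⟨x,y⟩ = 0), so each eigenplane
is J-nondegenerate (orthogonal symplectic planes), det σ = multiplier = ε̄ and σ is odd as ε̄(c) =
−1 for p odd; in the GU₂(p)-type Φ* = Φ^p the planes would instead be isotropic and σ' ≅ σ^∨ ⊗ ε̄;
End = 𝔽_p² gives absolute irreducibility of σ and σ ≇ σ^(p) (else ρ̄ would be isotypic over 𝔽_p,
contradicting 𝔽_p-irredu -/
@[route_item "route-Langlands-PhantomRM"]
def PhantomRMTransport : Prop :=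
  ∀ (p : ℕ) [Fact p.Prime], p ≠ 2 → ∀ (k : Type) [Field k] [CharP k p] [IsAlgClosed k] [TopologicalSpace k] [DiscreteTopology k] (ρb : Literature.NumberTheory.GaloisRepresentations.FramedGaloisRep ℚ (ZMod p) 4) (J Φ : Matrix (Fin 4) (Fin 4) (ZMod p)) (a b : ZMod p), J.transpose = -J → J.det ≠ 0 → (∀ g, (ρb g).val.transpose * J * (ρb g).val = ((Literature.NumberTheory.GaloisRepresentations.modPCyclotomicCharacterZMod ℚ p g : (ZMod p)ˣ) : ZMod p) • J) → Irreducible (Polynomial.X ^ 2 - Polynomial.C a * Polynomial.X - Polynomial.C b : Polynomial (ZMod p)) → Φ * Φ = a • Φ + b • (1 : Matrix (Fin 4) (Fin 4) (ZMod p)) → (∀ X : Matrix (Fin 4) (Fin 4) (ZMod p), (∀ g, X * (ρb g).val = (ρb g).val * X) ↔ ∃ c d : ZMod p, X = c • (1 : Matrix (Fin 4) (Fin 4) (ZMod p)) + d • Φ) → Φ.transpose * J = J * Φ → ρb.toGaloisRep.IsIrreducible → ∃ (σ : Literature.NumberTheory.GaloisRepresentations.FramedGaloisRep ℚ k 2)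 (g : Matrix.GeneralLinearGroup (Fin 4) k), σ.IsOdd ∧ σ.toGaloisRep.IsIrreducible ∧ (∀ x, Literature.NumberTheory.GaloisRepresentations.FramedRep.det σ x = Literature.NumberTheory.GaloisRepresentations.modPCyclotomicCharacter ℚ k p (ZMod.castHom (dvd_refl p) k) x) ∧ (∃ v, ∃ P P' : Polynomial k, σ.IsUnramifiedAt v ∧ Literature.NumberTheory.GaloisRepresentations.FramedGaloisRep.IsUnramifiedAt v (Literature.NumberTheory.GaloisRepresentations.FramedRep.baseChange (frobenius k p) continuous_of_discreteTopology σ) ∧ σ.HasFrobCharpolyAt v P ∧ Literature.NumberTheory.GaloisRepresentations.FramedGaloisRep.HasFrobCharpolyAt v P' (Literature.NumberTheory.GaloisRepresentations.FramedRep.baseChange (frobenius k p) continuous_of_discreteTopology σ) ∧ P ≠ P') ∧ ∀ x, (g⁻¹ * (Literature.NumberTheory.GaloisRepresentations.FramedRep.baseChange (ZMod.castHom (dvd_refl p) k) continuous_of_discreteTopology ρb) x * g).val = Matrix.reindex finSumFinEquiv finSumFinEquiv (Matrix.fromBlocks (σ x).val 0 0 ((Literature.NumberTheory.GaloisRepresentations.FramedRep.baseChange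 (frobenius k p) continuous_of_discreteTopology σ) x).val)

-- item stmt-Langlands-3684 · support · rank 9 · closed · moot by None · by planner — informal only, no Lean statement yet:
--   [support] REGULAR-WEIGHT DRESS REHEARSAL (card P3/P4 spirit; provable-soon check that the
--   Galois-theoretic half of crux 3 works before the irregular weight is attempted): same as
--   ResiduallyYoshidaLifting but with `Sh` replaced by "symplectic with multiplier ε^(m) · (finite
--   order), crystalline/ordinary at p with FOUR DISTINCT Hodge–Tate weights (regular), p-distinguished,
--   residual pair (σ̄, σ̄') orthogonal Yoshida type" — i.e. ρ₀, ρ : Γ_ℚ → GSp₄(ℚ̄_p) ordinary of regular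
--   weight (k₁ > k₂ ≥ 2... HT {0, k₂−1, k₁, k₁+k₂−1}-type), ρ̄^ss ≅ σ̄ ⊕ σ̄' multiplicity-free with σ̄,
--   σ̄' odd irreducible det-c

/-- item stmt-Langlands-3652 · assembly · rank 1 · closed · moot by None · by planner
sources: Thorne2014, BoxerCalegariGeePilloni2025
[assembly] SerreWeakKW → StableYoshidaCongruence → ResiduallyYoshidaLifting → PhantomRMSector (glue
= modus ponens; X is a sector of conjunct (B) for n = 4 over ℚ, not the summit). -/
@[route_item "route-Langlands-PhantomRM"]
def Assembly : Prop :=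
  SerreWeakKW → StableYoshidaCongruence → ResiduallyYoshidaLifting → PhantomRMSector

end Summit.Langlands.Langlands.Theses.PhantomRM
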